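import Literature.MathematicalPhysics.QuantumFieldTheory.Balaban1983to89.B9Eq325QGGQDecayPlaqClosedZd
import Literature.MathematicalPhysics.QuantumFieldTheory.Balaban1983to89.B9Eq325ProjFormulaZd

/-!
# `Balaban1983to89.B9Eq325RKernelDecayZd` — [Balaban1985BackgroundPropagators] (3.25) p. 394, (3.63)–(3.68) pp. 404–405, Thm 3.11 p. 416: THE KERNEL OF
# PRINT'S LAGRANGE-MULTIPLIER OPERATOR `R = I − G′Q′*(Q′G′²Q′*)⁻¹Q′G′` (dag-n06-w4 g2's `B9Eq325ProjFormulaZd.Rop`) DECAYS EXPONENTIALLY ON `L²(Ω₀, ·)`, with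
# ONE pair of constants over the closed small-field class — STATION 3 of the Combes–Thomas road at the `ℤᵈ` frame, closed per member by COMPOSING the
# five decaying ∕ block-local kernels `G′` (this seat's `B9Thm31GpDecayPlaqClosedZd`), `Q′`, `(Q′G′²Q′*)⁻¹` (this seat's `B9Eq325QGGQDecayPlaqClosedZd`), `Q′*`, `G′`

statement-level skeleton of published theorems with citation tags; proofs where landed; nothing here is a claim about the
Yang–Mills mass gap

`[Balaban1985BackgroundPropagators]` ("B9", CMP **99** (1985) 389–434): (3.25) p. 394 «Rf = (I − G′Q′*(Q′G′²Q′*)⁻¹Q′G′)f», (3.63)–(3.68) pp. 404–405 (locality of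
`R` from the decay of `G′` and of `(Q′G′²Q′*)⁻¹`), Thm 3.11 p. 416 (uniformity over the small-field class); [Balaban1985RegularSpaces] (1.7) p. 77.  HERE: the
kinematic composition at a finite member; every rate is halved at each composition (this seat's crude `B9Eq349KernelCompositionZd.exp_mul_exp_le_half`), the
constants are member-dependent and NOT print's.

CITATION HEADER (lean-in-tree rule).  Cell `pub-ymgap` (YM Track A, HUMAN RULING D-0062 ∕ D-0149 width push), DAG node N06 = [B9], width seat
`pub-ymgap-dag-n06-w2` (g4), CLAIM-9.  Inputs BY NAME: dag-n06-w4 g2's `B9Eq325ProjFormulaZd.{Rop, Rop_def}`, `B9Eq325QGGQInvZd.{QprimeVec, QprimeStar, cZd}`,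
this seat's `B9Eq325QGGQDecayPlaqClosedZd.exists_fnorm_cZd_single_le_exp_plaqClosed_uniform`, `B9Thm31GpDecayPlaqClosedZd.exists_fnorm_GpZd_single_le_exp_plaqClosed`,
`B9Eq325QGGQMajorantZd.{fnorm_QprimeIter_le_sum, fnorm_QprimeStar_levSingle_le, fnorm_apply_le_sum_of_blockDecay, linfDist_loc_lt_of_iterate_eq,
card_filter_iterate_eq_le}`, `B9Eq325QGGQDecayOfCoerciveZd.{levIndex, singleL, coordL, sum_singleL_coordL}`, `B9Eq349KernelCompositionZd.{exp_mul_exp_le_half,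
sum_exp_neg_mul_linfDist_le, sum_exp_neg_mul_linfDist_loc_le}`.  Nothing restated.

WHAT IS PROVED (kernel, 0 sorry, 0 def).
* §1 FOUR COMPOSITION STEPS with a source point `y`: `fnorm_QprimeVec_le_of_decay` (`Q′` of a field decaying from `y` decays from `y` between the constraint points
  `Lʲc`, constant `×(2Lᵐ+1)ᵈ·e^{κLᵐ}`), `fnorm_cZd_le_of_decay` (`(Q′G′²Q′*)⁻¹` of decaying level data decays at half the rate, constant `×C_c·(m+1)·K_d(μ∕2)`),
  `card_filter_blockOver_le` + `fnorm_QprimeStar_le_of_decay` (`Q′*` of decaying level data decays on the fine lattice, constant `×(m+1)·e^{νLᵐ}`),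
  `fnorm_GpZd_le_of_decay` (`G′` of a decaying field decays at half the rate, constant `×C·K_d(ν∕2)`).
* §2 ★★★ `exists_fnorm_Rop_single_le_exp_plaqClosed` — `0 < d`, `2 ≤ L`, `η ≠ 0`, `a ≥ 0`, `β < (α_Q∕L²)L^{−2m}`, `Q′*` injective on the class: there are
  `C_R > 0`, `κ_R > 0` with `|(R(U₀)δ_y w)(x)|_τ ≤ C_R·e^{−κ_R|x−y|_∞}·|w|_τ` for EVERY unitary `U₀` of the closed small-field class, every `y ∈ Ω₀`, `w`, `x` —
  print's locality of `R` ((3.63)–(3.68)), per member, for the operator `Rop` of (3.25) (which IS the constructed projection `R(U₀)` on Hermitian inputs by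
  dag-n06-w4 g2's `projE_eq_Rop_of_herm`).

HONEST SCOPE.  Count-neutral helper; crude member-dependent constants (rate `min(κ, κ″)∕4`); no estimate of [B9] with print's constants; N05 ∕ N06 NOT discharged;
K1⁸ `stmt-QuantumFields-26907` NOT closed; one finite `𝕋⁴` programme at fixed `ε`, Bałaban as printed; R4 closes only the conditional finite-`𝕋⁴` rung
`BalabanLadder.UV` — nothing continuum ∕ ℝ⁴ ∕ OS ∕ mass gap ∕ Clay.  Unit `pub-ymgap-dag-n06-w2` (g4), 2026-08-28.
-/

noncomputable section

open scoped BigOperators Nat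

namespace Literature.MathematicalPhysics.QuantumFieldTheory.Balaban1983to89.B9Eq325RKernelDecayZd

open Literature.MathematicalPhysics.QuantumLattice (blockMap)
open B7Eq78Linearization (QprimeIter zdBlocking)
open B7Prop2Explicit (unitaryUnits)
open B8Eq119TwistedAxial (bgT)
open B8Ineq132 (plaqF)
open B9Eq321LandauProjectionZd (suppSub)
open B9Eq324DeltaPrimeAZd (single restrictSite GpZd)
open B9Eq325QGGQInvZd (levSupp QprimeVec QprimeStar cZd QprimeStarInjective)
open B9Eq325ProjFormulaZd (Rop Rop_def)
open B9Eq316AveragingTransposeZd (alphaQ)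
open B9Eq342CombesThomasFormZd (fnorm fnorm_nonneg fnorm_zero fnorm_smul fnorm_add_le fnorm_sum_le blockAt single_apply_self single_apply_of_ne restrictSite_single_coe)
open B9Eq325QGGQDecayOfCoerciveZd (levIndex mem_levIndex_iff singleL singleL_coe coordL coordL_apply sum_singleL_coordL)
open B9Eq325QGGQMajorantZd (fnorm_QprimeIter_le_sum fnorm_QprimeStar_levSingle_le fnorm_apply_le_sum_of_blockDecay linfDist_loc_lt_of_iterate_eq
  card_filter_iterate_eq_le)
open B9Eq325QGGQDecayPlaqClosedZd (card_filter_loc_eq_le exists_fnorm_cZd_single_le_exp_plaqClosed_uniform)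
open B9Eq349KernelCompositionZd (exp_mul_exp_le_half sum_exp_neg_mul_linfDist_le sum_exp_neg_mul_linfDist_loc_le)
open LatticeNorms (linfDist)

export B7Prop1Explicit (Site)

variable {d : ℕ} {𝔸 : Type*} [CStarAlgebra 𝔸]

/-! ## §1  Four composition steps with a source point `y` -/

section Steps

variable (L : ℕ) (U₀ : Site d → Fin d → 𝔸ˣ) (η : ℝ) (τ : 𝔸 →ₗ[ℂ] ℂ)
  (hτp : ∀ a : 𝔸, a ≠ 0 → 0 < (τ (star a * a)).re) (m : ℕ) (a : ℕ → ℝ) (Λ : ℕ → Finset (Site d)) (s : Finset (Site d))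

include hτp in
/-- **STEP `Q′`**: if `|f(z)|_τ ≤ A·e^{−κ|z−y|_∞}` on `Ω₀` (`A, κ ≥ 0`, unitary averaged transporters `< m`, `L ≥ 1`), then at every constraint point `p = (j,c) ∈ 𝔅`:
`|(Q′f)(p)|_τ ≤ A·(2Lᵐ+1)ᵈ·e^{κLᵐ}·e^{−κ|Lʲc − y|_∞}`. [cite: Balaban1985BackgroundPropagators, (3.19) p.393, (3.63)–(3.68) pp.404–405] -/
theorem fnorm_QprimeVec_le_of_decay (hτt : ∀ a b : 𝔸, τ (a * b) = τ (b * a)) (hτs : ∀ a : 𝔸, τ (star a) = starRingEnd ℂ (τ a)) (hL : 1 ≤ L) (hT : ∀ j', j' < m → ∀ c x, bgT L U₀ j' c x ∈ unitaryUnits 𝔸) (f : suppSub (𝔸 := 𝔸) s)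
    {A κ : ℝ} (hA : 0 ≤ A) (hκ : 0 ≤ κ) (y : Site d) (hf : ∀ z ∈ s, fnorm τ ((f : Site d → 𝔸) z) ≤ A * Real.exp (-(κ * (linfDist z y : ℝ))))
    {p : ℕ × Site d} (hp : p ∈ levIndex m Λ) :
    fnorm τ ((QprimeVec L U₀ m Λ s f : ℕ × Site d → 𝔸) p) ≤
      A * (((2 * L ^ m + 1) ^ d : ℕ) : ℝ) * Real.exp (κ * (L ^ m : ℕ)) * Real.exp (-(κ * (linfDist (fun i => ((L : ℤ) ^ p.1) * p.2 i) y : ℝ))) := by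
  classical
  obtain ⟨j, c⟩ := p
  have hmem := (mem_levIndex_iff m Λ _).1 hp
  have hj : j ≤ m := Nat.le_of_lt_succ (Finset.mem_range.mp hmem.1)
  have hcoe : (QprimeVec L U₀ m Λ s f : ℕ × Site d → 𝔸) (j, c) = QprimeIter (zdBlocking d L) (bgT L U₀) j (f : Site d → 𝔸) c := by
    show (if (j, c).1 ∈ Finset.range (m + 1) ∧ (j, c).2 ∈ Λ (j, c).1 then QprimeIter (zdBlocking d L) (bgT L U₀) (j, c).1 (f : Site d → 𝔸) (j, c).2 else 0) = _
    rw [if_pos hmem]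
  rw [hcoe]
  set loc : Site d := fun i => ((L : ℤ) ^ j) * c i with hloc
  refine (fnorm_QprimeIter_le_sum τ (bgT L U₀) hτp hτt hτs hL s (fun z hz => f.2 z hz) j (fun j'' hj'' => hT j'' (by omega)) c).trans ?_
  have hterm : ∀ z ∈ s.filter (fun z => (blockMap L)^[j] z = c),
      fnorm τ ((f : Site d → 𝔸) z) ≤ A * Real.exp (κ * (L ^ m : ℕ)) * Real.exp (-(κ * (linfDist loc y : ℝ))) := by
    intro z hz
    rw [Finset.mem_filter] at hz
    refine (hf z hz.1).trans ?_
    rw [mul_assoc, ← Real.exp_add]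
    refine mul_le_mul_of_nonneg_left (Real.exp_le_exp.mpr ?_) hA
    have h1 : linfDist z loc + 1 ≤ L ^ j := linfDist_loc_lt_of_iterate_eq hL hz.2
    have hLj : L ^ j ≤ L ^ m := Nat.pow_le_pow_right hL hj
    have t := LatticeNorms.linfDist_triangle loc z y
    have c1 : linfDist loc z = linfDist z loc := LatticeNorms.linfDist_comm _ _
    have hcast : (linfDist loc y : ℝ) ≤ (L ^ m : ℕ) + (linfDist z y : ℝ) := by
      have : linfDist loc y ≤ L ^ m + linfDist z y := by omega
      exact_mod_cast this
    nlinarith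
  refine (Finset.sum_le_sum hterm).trans ?_
  rw [Finset.sum_const, nsmul_eq_mul]
  have hcard : ((s.filter (fun z => (blockMap L)^[j] z = c)).card : ℝ) ≤ (((2 * L ^ m + 1) ^ d : ℕ) : ℝ) := by
    have h := card_filter_iterate_eq_le hL s j c
    have h' : (2 * L ^ j + 1) ^ d ≤ (2 * L ^ m + 1) ^ d := Nat.pow_le_pow_left (by linarith [Nat.pow_le_pow_right hL hj]) d
    exact_mod_cast h.trans h'
  calc ((s.filter (fun z => (blockMap L)^[j] z = c)).card : ℝ) * (A * Real.exp (κ * (L ^ m : ℕ)) * Real.exp (-(κ * (linfDist loc y : ℝ))))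
      ≤ (((2 * L ^ m + 1) ^ d : ℕ) : ℝ) * (A * Real.exp (κ * (L ^ m : ℕ)) * Real.exp (-(κ * (linfDist loc y : ℝ)))) :=
        mul_le_mul_of_nonneg_right hcard (by positivity)
    _ = _ := by ring

/-- the constraint points over a fine site `x` — one per level — are at most `m+1`. [cite: Balaban1985BackgroundPropagators, (3.19) p.393 (bookkeeping)] -/
theorem card_filter_blockOver_le (x : Site d) :
    ((levIndex m Λ).filter (fun p' : ℕ × Site d => (blockMap L)^[p'.1] x = p'.2)).card ≤ m + 1 := by
  classical
  have h := Finset.card_le_card_of_injOn (s := (levIndex m Λ).filter (fun p' : ℕ × Site d => (blockMap L)^[p'.1] x = p'.2))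
    (t := Finset.range (m + 1)) Prod.fst (fun z hz => by
      rw [Finset.mem_coe, Finset.mem_filter, mem_levIndex_iff] at hz
      exact hz.1.1) (by
      intro z hz z' hz' hzz
      rw [Finset.mem_coe, Finset.mem_filter] at hz hz'
      refine Prod.ext hzz ?_
      have h1 : (blockMap L)^[z.1] x = z.2 := hz.2
      have h2 : (blockMap L)^[z'.1] x = z'.2 := hz'.2
      have hj : z'.1 = z.1 := hzz.symm
      rw [hj] at h2
      exact h1.symm.trans h2)
  rwa [Finset.card_range] at h

variable [FiniteDimensional ℝ 𝔸]

/-- **STEP `(Q′G′²Q′*)⁻¹`**: if `|ψ(p′)|_τ ≤ B·e^{−μ|loc p′ − y|_∞}` on `𝔅` and the blocks of `(Q′G′²Q′*)⁻¹` decay at rate `μ > 0` with constant `C_c` between the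
localised constraint points, then `|((Q′G′²Q′*)⁻¹ψ)(p)|_τ ≤ C_c·B·(m+1)·K_d(μ∕2)·e^{−(μ∕2)|loc p − y|_∞}` (`p ∈ 𝔅`, `L ≥ 1`).
[cite: Balaban1985BackgroundPropagators, (3.25) p.394, Thm 3.2 p.398, (3.63)–(3.68) pp.404–405] -/
theorem fnorm_cZd_le_of_decay (hd : 0 < d) (hη : η ≠ 0) (hτt : ∀ a b : 𝔸, τ (a * b) = τ (b * a)) (hτs : ∀ a : 𝔸, τ (star a) = starRingEnd ℂ (τ a))
    (hU : ∀ (x : Site d) (κ : Fin d), U₀ x κ ∈ unitaryUnits 𝔸) (ha : ∀ j, 0 ≤ a j) (hL : 1 ≤ L) (hinj : QprimeStarInjective L U₀ τ hτp m Λ s) (ψ : levSupp (𝔸 := 𝔸) m Λ) {B μ : ℝ} (hB : 0 ≤ B)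
    (hμ : 0 < μ) (y : Site d)
    (hψ : ∀ p' ∈ levIndex m Λ, fnorm τ ((ψ : ℕ × Site d → 𝔸) p') ≤ B * Real.exp (-(μ * (linfDist (fun i => ((L : ℤ) ^ p'.1) * p'.2 i) y : ℝ))))
    {Cc : ℝ} (hCc : 0 ≤ Cc)
    (hcZ : ∀ p ∈ levIndex m Λ, ∀ p' ∈ levIndex m Λ, ∀ w : 𝔸,
      fnorm τ ((cZd L U₀ η τ hτp m a Λ s hd hη hτt hτs hU ha hinj (singleL m Λ p' w) : ℕ × Site d → 𝔸) p) ≤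
        Cc * Real.exp (-(μ * (linfDist (fun i => ((L : ℤ) ^ p.1) * p.2 i) (fun i => ((L : ℤ) ^ p'.1) * p'.2 i) : ℝ))) * fnorm τ w)
    {p : ℕ × Site d} (hp : p ∈ levIndex m Λ) :
    fnorm τ ((cZd L U₀ η τ hτp m a Λ s hd hη hτt hτs hU ha hinj ψ : ℕ × Site d → 𝔸) p) ≤
      Cc * B * ((m + 1 : ℕ) * ((3 : ℝ) ^ d * (d ! : ℝ) * (2 / (μ / 2)) ^ d * Real.exp (μ / 2 / 2) / (1 - Real.exp (-(μ / 2 / 2))))) *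
        Real.exp (-(μ / 2 * (linfDist (fun i => ((L : ℤ) ^ p.1) * p.2 i) y : ℝ))) := by
  classical
  set loc : ℕ × Site d → Site d := fun q => fun i => ((L : ℤ) ^ q.1) * q.2 i with hloc
  set T := cZd L U₀ η τ hτp m a Λ s hd hη hτt hτs hU ha hinj with hT
  have happ : (T ψ : ℕ × Site d → 𝔸) p = ∑ p' ∈ levIndex m Λ, (T (singleL m Λ p' ((ψ : ℕ × Site d → 𝔸) p')) : ℕ × Site d → 𝔸) p := by
    conv_lhs => rw [← sum_singleL_coordL m Λ ψ]
    rw [map_sum, AddSubmonoidClass.coe_finsetSum, Finset.sum_apply]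
    rfl
  rw [happ]
  refine (fnorm_sum_le hτp hτs _ _).trans ?_
  have hterm : ∀ p' ∈ levIndex m Λ, fnorm τ ((T (singleL m Λ p' ((ψ : ℕ × Site d → 𝔸) p')) : ℕ × Site d → 𝔸) p) ≤
      Cc * B * (Real.exp (-(μ * (linfDist (loc p) (loc p') : ℝ))) * Real.exp (-(μ * (linfDist (loc p') y : ℝ)))) := by
    intro p' hp'
    refine (hcZ p hp p' hp' _).trans ?_
    calc Cc * Real.exp (-(μ * (linfDist (loc p) (loc p') : ℝ))) * fnorm τ ((ψ : ℕ × Site d → 𝔸) p')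
        ≤ Cc * Real.exp (-(μ * (linfDist (loc p) (loc p') : ℝ))) * (B * Real.exp (-(μ * (linfDist (loc p') y : ℝ)))) :=
          mul_le_mul_of_nonneg_left (hψ p' hp') (by positivity)
      _ = _ := by ring
  refine (Finset.sum_le_sum hterm).trans ?_
  rw [← Finset.mul_sum]
  have hdist0 : ∀ a b : Site d, (0 : ℝ) ≤ (linfDist a b : ℝ) := fun a b => Nat.cast_nonneg _
  have hdt : ∀ a b c : Site d, (linfDist a c : ℝ) ≤ (linfDist a b : ℝ) + (linfDist b c : ℝ) :=
    fun a b c => by exact_mod_cast LatticeNorms.linfDist_triangle a b c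
  have h1 : ∑ p' ∈ levIndex m Λ, Real.exp (-(μ * (linfDist (loc p) (loc p') : ℝ))) * Real.exp (-(μ * (linfDist (loc p') y : ℝ))) ≤
      Real.exp (-(μ / 2 * (linfDist (loc p) y : ℝ))) * ∑ p' ∈ levIndex m Λ, Real.exp (-(μ / 2 * (linfDist (loc p) (loc p') : ℝ))) := by
    rw [Finset.mul_sum]
    exact Finset.sum_le_sum fun p' _ => exp_mul_exp_le_half hdist0 hdt hμ.le (loc p) (loc p') y
  have h2 := sum_exp_neg_mul_linfDist_loc_le (d := d) (half_pos hμ) (levIndex m Λ) loc (card_filter_loc_eq_le hL m Λ) p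
  have hK0 : 0 ≤ ((m + 1 : ℕ) : ℝ) * ((3 : ℝ) ^ d * (d ! : ℝ) * (2 / (μ / 2)) ^ d * Real.exp (μ / 2 / 2) / (1 - Real.exp (-(μ / 2 / 2)))) :=
    le_trans (Finset.sum_nonneg fun _ _ => (Real.exp_pos _).le) h2
  calc Cc * B * ∑ p' ∈ levIndex m Λ, Real.exp (-(μ * (linfDist (loc p) (loc p') : ℝ))) * Real.exp (-(μ * (linfDist (loc p') y : ℝ)))
      ≤ Cc * B * (Real.exp (-(μ / 2 * (linfDist (loc p) y : ℝ))) *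
          (((m + 1 : ℕ) : ℝ) * ((3 : ℝ) ^ d * (d ! : ℝ) * (2 / (μ / 2)) ^ d * Real.exp (μ / 2 / 2) / (1 - Real.exp (-(μ / 2 / 2)))))) :=
        mul_le_mul_of_nonneg_left (h1.trans (mul_le_mul_of_nonneg_left h2 (Real.exp_pos _).le)) (mul_nonneg hCc hB)
    _ = _ := by ring

/-- **STEP `Q′*`**: if `|ψ(p′)|_τ ≤ B·e^{−ν|loc p′ − y|_∞}` on `𝔅` (`B, ν ≥ 0`, unitary averaged transporters `< m`, `L ≥ 1`, faithful Hermitian tracial `τ`), then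
on the fine lattice `|(Q′*ψ)(x)|_τ ≤ (m+1)·B·e^{νLᵐ}·e^{−ν|x − y|_∞}`. [cite: Balaban1985BackgroundPropagators, (3.24)–(3.25) p.394, (3.63)–(3.68) pp.404–405] -/
theorem fnorm_QprimeStar_le_of_decay (hτt : ∀ a b : 𝔸, τ (a * b) = τ (b * a)) (hτs : ∀ a : 𝔸, τ (star a) = starRingEnd ℂ (τ a)) (hL : 1 ≤ L) (hT : ∀ j', j' < m → ∀ c x, bgT L U₀ j' c x ∈ unitaryUnits 𝔸) (ψ : levSupp (𝔸 := 𝔸) m Λ)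
    {B ν : ℝ} (hB : 0 ≤ B) (hν : 0 ≤ ν) (y : Site d)
    (hψ : ∀ p' ∈ levIndex m Λ, fnorm τ ((ψ : ℕ × Site d → 𝔸) p') ≤ B * Real.exp (-(ν * (linfDist (fun i => ((L : ℤ) ^ p'.1) * p'.2 i) y : ℝ))))
    (x : Site d) :
    fnorm τ ((QprimeStar L U₀ τ m Λ s hτp ψ : Site d → 𝔸) x) ≤ ((m + 1 : ℕ) : ℝ) * B * Real.exp (ν * (L ^ m : ℕ)) * Real.exp (-(ν * (linfDist x y : ℝ))) := by
  classical
  set loc : ℕ × Site d → Site d := fun q => fun i => ((L : ℤ) ^ q.1) * q.2 i with hloc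
  have happ : (QprimeStar L U₀ τ m Λ s hτp ψ : Site d → 𝔸) x =
      ∑ p' ∈ levIndex m Λ, (QprimeStar L U₀ τ m Λ s hτp (singleL m Λ p' ((ψ : ℕ × Site d → 𝔸) p')) : Site d → 𝔸) x := by
    conv_lhs => rw [← sum_singleL_coordL m Λ ψ]
    rw [map_sum, AddSubmonoidClass.coe_finsetSum, Finset.sum_apply]
    rfl
  rw [happ]
  refine (fnorm_sum_le hτp hτs _ _).trans ?_
  have hterm : ∀ p' ∈ levIndex m Λ, fnorm τ ((QprimeStar L U₀ τ m Λ s hτp (singleL m Λ p' ((ψ : ℕ × Site d → 𝔸) p')) : Site d → 𝔸) x) ≤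
      if (blockMap L)^[p'.1] x = p'.2 then B * Real.exp (ν * (L ^ m : ℕ)) * Real.exp (-(ν * (linfDist x y : ℝ))) else 0 := by
    rintro ⟨j', y'⟩ hp'
    have hj' : j' ≤ m := Nat.le_of_lt_succ (Finset.mem_range.mp ((mem_levIndex_iff m Λ _).1 hp').1)
    refine (fnorm_QprimeStar_levSingle_le L U₀ τ hτp m Λ s hτt hτs hL hT hj' (singleL_coe m Λ hp' _) x).trans ?_
    by_cases hblk : (blockMap L)^[j'] x = y'
    · rw [if_pos hblk]
      split_ifs with hxs
      · refine (hψ (j', y') hp').trans ?_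
        rw [mul_assoc, ← Real.exp_add]
        refine mul_le_mul_of_nonneg_left (Real.exp_le_exp.mpr ?_) hB
        have h1 : linfDist x (loc (j', y')) + 1 ≤ L ^ j' := linfDist_loc_lt_of_iterate_eq hL hblk
        have hLj : L ^ j' ≤ L ^ m := Nat.pow_le_pow_right hL hj'
        have t := LatticeNorms.linfDist_triangle x (loc (j', y')) y
        have hcast : (linfDist x y : ℝ) ≤ (L ^ m : ℕ) + (linfDist (loc (j', y')) y : ℝ) := by
          have : linfDist x y ≤ L ^ m + linfDist (loc (j', y')) y := by omega
          exact_mod_cast this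
        nlinarith
      · positivity
    · rw [if_neg (fun h => hblk h.2), if_neg hblk]
  refine (Finset.sum_le_sum hterm).trans ?_
  rw [← Finset.sum_filter, Finset.sum_const, nsmul_eq_mul]
  have hcard : (((levIndex m Λ).filter (fun p' : ℕ × Site d => (blockMap L)^[p'.1] x = p'.2)).card : ℝ) ≤ ((m + 1 : ℕ) : ℝ) := by
    exact_mod_cast card_filter_blockOver_le L m Λ x
  calc (((levIndex m Λ).filter (fun p' : ℕ × Site d => (blockMap L)^[p'.1] x = p'.2)).card : ℝ) *
        (B * Real.exp (ν * (L ^ m : ℕ)) * Real.exp (-(ν * (linfDist x y : ℝ))))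
      ≤ ((m + 1 : ℕ) : ℝ) * (B * Real.exp (ν * (L ^ m : ℕ)) * Real.exp (-(ν * (linfDist x y : ℝ)))) := mul_le_mul_of_nonneg_right hcard (by positivity)
    _ = _ := by ring

/-- **STEP `G′`**: if `|v(x′)|_τ ≤ B·e^{−ν|x′−y|_∞}` on `Ω₀` (`B ≥ 0`, `0 < ν ≤ κ`) and the blocks of `G′(U₀)` decay with `(C, κ)`, then
`|(G′v)(x)|_τ ≤ C·B·K_d(ν∕2)·e^{−(ν∕2)|x−y|_∞}`. [cite: Balaban1985BackgroundPropagators, (3.42) p.397, (3.63)–(3.68) pp.404–405, (3.107)–(3.108) pp.415–416] -/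
theorem fnorm_GpZd_le_of_decay (hd : 0 < d) (hη : η ≠ 0) (hτt : ∀ a b : 𝔸, τ (a * b) = τ (b * a)) (hτs : ∀ a : 𝔸, τ (star a) = starRingEnd ℂ (τ a))
    (hU : ∀ (x : Site d) (κ : Fin d), U₀ x κ ∈ unitaryUnits 𝔸) (ha : ∀ j, 0 ≤ a j) (v : suppSub (𝔸 := 𝔸) s) {B ν : ℝ} (hB : 0 ≤ B) (hν : 0 < ν) (y : Site d)
    (hv : ∀ x' ∈ s, fnorm τ ((v : Site d → 𝔸) x') ≤ B * Real.exp (-(ν * (linfDist x' y : ℝ)))) {C κ : ℝ} (hC : 0 ≤ C) (hνκ : ν ≤ κ)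
    (hG : ∀ x' ∈ s, ∀ (u : 𝔸) (x : Site d),
      fnorm τ (blockAt s (GpZd L U₀ η τ hτp m a Λ s hd hη hτt hτs hU ha).toLinearMap x' u x) ≤ C * Real.exp (-(κ * (linfDist x x' : ℝ))) * fnorm τ u)
    (x : Site d) :
    fnorm τ ((GpZd L U₀ η τ hτp m a Λ s hd hη hτt hτs hU ha v : Site d → 𝔸) x) ≤
      C * B * ((3 : ℝ) ^ d * (d ! : ℝ) * (2 / (ν / 2)) ^ d * Real.exp (ν / 2 / 2) / (1 - Real.exp (-(ν / 2 / 2)))) *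
        Real.exp (-(ν / 2 * (linfDist x y : ℝ))) := by
  have h0 := fnorm_apply_le_sum_of_blockDecay τ hτp hτs (GpZd L U₀ η τ hτp m a Λ s hd hη hτt hτs hU ha).toLinearMap hG v x
  refine h0.trans ?_
  have hdist0 : ∀ a b : Site d, (0 : ℝ) ≤ (linfDist a b : ℝ) := fun a b => Nat.cast_nonneg _
  have hdt : ∀ a b c : Site d, (linfDist a c : ℝ) ≤ (linfDist a b : ℝ) + (linfDist b c : ℝ) :=
    fun a b c => by exact_mod_cast LatticeNorms.linfDist_triangle a b c
  have hterm : ∀ x' ∈ s, C * Real.exp (-(κ * (linfDist x x' : ℝ))) * fnorm τ ((v : Site d → 𝔸) x') ≤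
      C * B * (Real.exp (-(ν / 2 * (linfDist x y : ℝ))) * Real.exp (-(ν / 2 * (linfDist x x' : ℝ)))) := by
    intro x' hx'
    have hweak : Real.exp (-(κ * (linfDist x x' : ℝ))) ≤ Real.exp (-(ν * (linfDist x x' : ℝ))) :=
      Real.exp_le_exp.mpr (by nlinarith [hdist0 x x'])
    calc C * Real.exp (-(κ * (linfDist x x' : ℝ))) * fnorm τ ((v : Site d → 𝔸) x')
        ≤ C * Real.exp (-(ν * (linfDist x x' : ℝ))) * (B * Real.exp (-(ν * (linfDist x' y : ℝ)))) :=
          mul_le_mul (mul_le_mul_of_nonneg_left hweak hC) (hv x' hx') (fnorm_nonneg τ _) (by positivity)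
      _ = C * B * (Real.exp (-(ν * (linfDist x x' : ℝ))) * Real.exp (-(ν * (linfDist x' y : ℝ)))) := by ring
      _ ≤ C * B * (Real.exp (-(ν / 2 * (linfDist x y : ℝ))) * Real.exp (-(ν / 2 * (linfDist x x' : ℝ)))) :=
          mul_le_mul_of_nonneg_left (exp_mul_exp_le_half hdist0 hdt hν.le x x' y) (mul_nonneg hC hB)
  refine (Finset.sum_le_sum hterm).trans ?_
  rw [← Finset.mul_sum, ← Finset.mul_sum]
  have h2 := sum_exp_neg_mul_linfDist_le (d := d) (half_pos hν) s x
  calc C * B * (Real.exp (-(ν / 2 * (linfDist x y : ℝ))) * ∑ x' ∈ s, Real.exp (-(ν / 2 * (linfDist x x' : ℝ))))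
      ≤ C * B * (Real.exp (-(ν / 2 * (linfDist x y : ℝ))) *
          ((3 : ℝ) ^ d * (d ! : ℝ) * (2 / (ν / 2)) ^ d * Real.exp (ν / 2 / 2) / (1 - Real.exp (-(ν / 2 / 2))))) :=
        mul_le_mul_of_nonneg_left (mul_le_mul_of_nonneg_left h2 (Real.exp_pos _).le) (mul_nonneg hC hB)
    _ = _ := by ring

end Steps

/-! ## §2  ★★★ The kernel of `R = I − G′Q′*(Q′G′²Q′*)⁻¹Q′G′` decays, uniformly over the closed small-field class -/

section Station3

variable (L : ℕ) (η : ℝ) (τ : 𝔸 →ₗ[ℂ] ℂ) [FiniteDimensional ℝ 𝔸] [Nontrivial 𝔸]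
  (hτp : ∀ a : 𝔸, a ≠ 0 → 0 < (τ (star a * a)).re) (hτt : ∀ a b : 𝔸, τ (a * b) = τ (b * a)) (hτs : ∀ a : 𝔸, τ (star a) = starRingEnd ℂ (τ a))
  (m : ℕ) (a : ℕ → ℝ) (Λ : ℕ → Finset (Site d)) (s : Finset (Site d))

include hτt hτs in
/-- ★★★ **STATION 3: PRINT'S LOCALITY OF `R` ((3.63)–(3.68)), PER MEMBER, FOR THE OPERATOR `Rop` OF (3.25).**  `0 < d`, `2 ≤ L`, `η ≠ 0`, `a ≥ 0`, finite `Ω₀ = s`,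
faithful Hermitian tracial `τ` on a finite-dimensional nontrivial fibre, `β < (α_Q∕L²)·L^{−2m}`, `Q′*` injective at every unitary background.  Then there are
`C_R > 0`, `κ_R > 0` such that for EVERY unitary `U₀` with `‖U₀(∂p) − 1‖ ≤ β` at all plaquettes, every `y ∈ Ω₀`, `w`, and every site `x`:
`|(R(U₀)δ_y w)(x)|_τ ≤ C_R·e^{−κ_R|x−y|_∞}·|w|_τ`, `R(U₀) = I − G′Q′*(Q′G′²Q′*)⁻¹Q′G′`.  (Composition of this seat's stations 1 and 2 through `Q′`, `Q′*`.)
[cite: Balaban1985BackgroundPropagators, (3.25) p.394, (3.63)–(3.68) pp.404–405, Thm 3.1 p.397, Thm 3.2 p.398, Thm 3.11 p.416; Balaban1985RegularSpaces, (1.7) p.77] -/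
theorem exists_fnorm_Rop_single_le_exp_plaqClosed (hd : 0 < d) (hL : 2 ≤ L) (hη : η ≠ 0) (ha : ∀ j, 0 ≤ a j) {β : ℝ}
    (hβ : β < alphaQ d L / (L : ℝ) ^ 2 * (((L : ℝ) ^ m)⁻¹) ^ 2)
    (hinj : ∀ U₀ : Site d → Fin d → 𝔸ˣ, (∀ x κ, U₀ x κ ∈ unitaryUnits 𝔸) → QprimeStarInjective L U₀ τ hτp m Λ s) :
    ∃ CR : ℝ, 0 < CR ∧ ∃ κR : ℝ, 0 < κR ∧ ∀ (U₀ : Site d → Fin d → 𝔸ˣ) (hU : ∀ x κ', U₀ x κ' ∈ unitaryUnits 𝔸),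
      (∀ (x : Site d) (μ ν : Fin d), ‖plaqF U₀ μ ν x - 1‖ ≤ β) →
        ∀ y ∈ s, ∀ (w : 𝔸) (x : Site d),
          fnorm τ ((Rop L U₀ η τ hτp m a Λ s hd hη hτt hτs hU ha (hinj U₀ hU) (restrictSite s (single y w)) : Site d → 𝔸) x) ≤
            CR * Real.exp (-(κR * (linfDist x y : ℝ))) * fnorm τ w := by
  classical
  have hL1 : 1 ≤ L := le_trans one_le_two hL
  obtain ⟨C, hC, κ, hκ, hdec⟩ := B9Thm31GpDecayPlaqClosedZd.exists_fnorm_GpZd_single_le_exp_plaqClosed L η τ hτp hτt hτs m a Λ s hd hL hη ha hβ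
  obtain ⟨Cc, hCc, κc, hκc, hcdec⟩ := exists_fnorm_cZd_single_le_exp_plaqClosed_uniform L η τ hτp hτt hτs m a Λ s hd hL hη ha hβ hinj
  -- the common rate and the constants
  obtain ⟨μ, hμdef⟩ : ∃ μ : ℝ, μ = min κ κc := ⟨_, rfl⟩
  have hμ0 : 0 < μ := by rw [hμdef]; exact lt_min hκ hκc
  have hμκ : μ ≤ κ := by rw [hμdef]; exact min_le_left _ _
  have hμκc : μ ≤ κc := by rw [hμdef]; exact min_le_right _ _
  obtain ⟨N, hN⟩ : ∃ N : ℝ, N = (((2 * L ^ m + 1) ^ d : ℕ) : ℝ) := ⟨_, rfl⟩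
  obtain ⟨K2, hK2⟩ : ∃ K : ℝ, K = (3 : ℝ) ^ d * (d ! : ℝ) * (2 / (μ / 2)) ^ d * Real.exp (μ / 2 / 2) / (1 - Real.exp (-(μ / 2 / 2))) := ⟨_, rfl⟩
  obtain ⟨K4, hK4⟩ : ∃ K : ℝ, K = (3 : ℝ) ^ d * (d ! : ℝ) * (2 / (μ / 2 / 2)) ^ d * Real.exp (μ / 2 / 2 / 2) / (1 - Real.exp (-(μ / 2 / 2 / 2))) := ⟨_, rfl⟩
  have hN0 : 0 ≤ N := by rw [hN]; positivity
  have hK20 : 0 ≤ K2 := by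
    have h := sum_exp_neg_mul_linfDist_le (d := d) (half_pos hμ0) ∅ (0 : Site d)
    rw [Finset.sum_empty] at h; rw [hK2]; exact h
  have hK40 : 0 ≤ K4 := by
    have h := sum_exp_neg_mul_linfDist_le (d := d) (half_pos (half_pos hμ0)) ∅ (0 : Site d)
    rw [Finset.sum_empty] at h; rw [hK4]; exact h
  set E1 : ℝ := Real.exp (μ * (L ^ m : ℕ)) with hE1
  set E2 : ℝ := Real.exp (μ / 2 * (L ^ m : ℕ)) with hE2
  -- the constant of the five-fold composition
  set C5 : ℝ := C * (((m + 1 : ℕ) : ℝ) * (Cc * (C * N * E1) * (((m + 1 : ℕ) : ℝ) * K2)) * E2) * K4 with hC5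
  have hC50 : 0 ≤ C5 := by rw [hC5]; positivity
  refine ⟨1 + C5, by positivity, μ / 2 / 2, by positivity, fun U₀ hU hplaq y hy w x => ?_⟩
  have hw0 : 0 ≤ fnorm τ w := fnorm_nonneg τ w
  have hreg := B9Thm31CoercivePrimeCompactZd.reg17Univ_of_forall_plaqF_le (𝔸 := 𝔸) hL1 m hβ hplaq
  have hT : ∀ j', j' < m → ∀ c0 x, bgT L U₀ j' c0 x ∈ unitaryUnits 𝔸 :=
    fun j' hj' c0 x => B9Thm311PosDefNearFlatZd.bgT_mem_unitaryUnits_of_reg17UnivP hd hL m hU hreg j' hj'.le c0 x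
  have hGblk : ∀ x' ∈ s, ∀ (u : 𝔸) (x : Site d),
      fnorm τ (blockAt s (GpZd L U₀ η τ hτp m a Λ s hd hη hτt hτs hU ha).toLinearMap x' u x) ≤ C * Real.exp (-(κ * (linfDist x x' : ℝ))) * fnorm τ u :=
    fun x' hx' u x => hdec U₀ hU hplaq x' hx' u x
  -- the letters
  set f : suppSub (𝔸 := 𝔸) s := restrictSite s (single y w) with hf
  set G := GpZd L U₀ η τ hτp m a Λ s hd hη hτt hτs hU ha with hGdef
  set v1 := G f with hv1
  set ψ1 := QprimeVec L U₀ m Λ s v1 with hψ1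
  set ψ2 := cZd L U₀ η τ hτp m a Λ s hd hη hτt hτs hU ha (hinj U₀ hU) ψ1 with hψ2
  set v3 := QprimeStar L U₀ τ m Λ s hτp ψ2 with hv3
  set v4 := G v3 with hv4
  -- step 1: `G′δ_y w` decays at rate `κ ≥ μ`
  have h1 : ∀ z ∈ s, fnorm τ ((v1 : Site d → 𝔸) z) ≤ C * fnorm τ w * Real.exp (-(μ * (linfDist z y : ℝ))) := by
    intro z _
    refine (hdec U₀ hU hplaq y hy w z).trans ?_
    rw [mul_assoc, mul_assoc, mul_comm (Real.exp _) (fnorm τ w)]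
    refine mul_le_mul_of_nonneg_left (mul_le_mul_of_nonneg_left (Real.exp_le_exp.mpr ?_) (fnorm_nonneg τ w)) hC.le
    nlinarith [(Nat.cast_nonneg (linfDist z y) : (0 : ℝ) ≤ _)]
  -- step 2: `Q′`
  have h2 : ∀ p' ∈ levIndex m Λ, fnorm τ ((ψ1 : ℕ × Site d → 𝔸) p') ≤
      C * fnorm τ w * N * E1 * Real.exp (-(μ * (linfDist (fun i => ((L : ℤ) ^ p'.1) * p'.2 i) y : ℝ))) := by
    intro p' hp'
    have h := fnorm_QprimeVec_le_of_decay L U₀ τ hτp m Λ s hτt hτs hL1 hT v1 (mul_nonneg hC.le hw0) hμ0.le y h1 hp'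
    rw [hN, hE1]; exact h
  -- step 3: `(Q′G′²Q′*)⁻¹` at rate `μ ≤ κ_c`
  have hcZ : ∀ p ∈ levIndex m Λ, ∀ p' ∈ levIndex m Λ, ∀ w' : 𝔸,
      fnorm τ ((cZd L U₀ η τ hτp m a Λ s hd hη hτt hτs hU ha (hinj U₀ hU) (singleL m Λ p' w') : ℕ × Site d → 𝔸) p) ≤
        Cc * Real.exp (-(μ * (linfDist (fun i => ((L : ℤ) ^ p.1) * p.2 i) (fun i => ((L : ℤ) ^ p'.1) * p'.2 i) : ℝ))) * fnorm τ w' := by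
    intro p hp p' hp' w'
    refine (hcdec U₀ hU hplaq p hp p' hp' w').trans (mul_le_mul_of_nonneg_right (mul_le_mul_of_nonneg_left (Real.exp_le_exp.mpr ?_) hCc.le) (fnorm_nonneg τ _))
    nlinarith [(Nat.cast_nonneg (linfDist (fun i => ((L : ℤ) ^ p.1) * p.2 i) (fun i => ((L : ℤ) ^ p'.1) * p'.2 i)) : (0 : ℝ) ≤ _)]
  have h3 : ∀ p ∈ levIndex m Λ, fnorm τ ((ψ2 : ℕ × Site d → 𝔸) p) ≤
      Cc * (C * fnorm τ w * N * E1) * (((m + 1 : ℕ) : ℝ) * K2) * Real.exp (-(μ / 2 * (linfDist (fun i => ((L : ℤ) ^ p.1) * p.2 i) y : ℝ))) := by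
    intro p hp
    have h := fnorm_cZd_le_of_decay L U₀ η τ hτp m a Λ s hd hη hτt hτs hU ha hL1 (hinj U₀ hU) ψ1 (by positivity) hμ0 y h2 hCc.le hcZ hp
    rw [hK2]; exact h
  -- step 4: `Q′*`
  have h4 : ∀ x3, fnorm τ ((v3 : Site d → 𝔸) x3) ≤
      ((m + 1 : ℕ) : ℝ) * (Cc * (C * fnorm τ w * N * E1) * (((m + 1 : ℕ) : ℝ) * K2)) * E2 * Real.exp (-(μ / 2 * (linfDist x3 y : ℝ))) := by
    intro x3
    have h := fnorm_QprimeStar_le_of_decay L U₀ τ hτp m Λ s hτt hτs hL1 hT ψ2 (by positivity) (half_pos hμ0).le y h3 x3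
    rw [hE2]; exact h
  -- step 5: `G′` at rate `μ/2 ≤ κ`
  have h5 : fnorm τ ((v4 : Site d → 𝔸) x) ≤
      C * (((m + 1 : ℕ) : ℝ) * (Cc * (C * fnorm τ w * N * E1) * (((m + 1 : ℕ) : ℝ) * K2)) * E2) * K4 * Real.exp (-(μ / 2 / 2 * (linfDist x y : ℝ))) := by
    have h := fnorm_GpZd_le_of_decay L U₀ η τ hτp m a Λ s hd hη hτt hτs hU ha v3 (by positivity) (half_pos hμ0) y (fun x3 _ => h4 x3) hC.le
      (by linarith) hGblk x
    rw [hK4]; exact h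
  -- `R δ_y w = δ_y w − v4`
  have hR : (Rop L U₀ η τ hτp m a Λ s hd hη hτt hτs hU ha (hinj U₀ hU) f : Site d → 𝔸) x = (f : Site d → 𝔸) x - (v4 : Site d → 𝔸) x := by
    rw [Rop_def]; rfl
  rw [hR, sub_eq_add_neg]
  refine (fnorm_add_le hτp hτs _ _).trans ?_
  have hneg : fnorm τ (-(v4 : Site d → 𝔸) x) = fnorm τ ((v4 : Site d → 𝔸) x) := by
    rw [← neg_one_smul ℝ ((v4 : Site d → 𝔸) x), fnorm_smul]; simp
  rw [hneg]
  -- the identity part: `|δ_y w(x)|_τ ≤ e^{−κ_R|x−y|}|w|_τ`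
  have hδ : fnorm τ ((f : Site d → 𝔸) x) ≤ Real.exp (-(μ / 2 / 2 * (linfDist x y : ℝ))) * fnorm τ w := by
    rw [hf, restrictSite_single_coe hy]
    by_cases hxy : x = y
    · rw [hxy, single_apply_self, LatticeNorms.linfDist_self, Nat.cast_zero, mul_zero, neg_zero, Real.exp_zero, one_mul]
    · rw [single_apply_of_ne hxy, fnorm_zero]; positivity
  have hfac : C * (((m + 1 : ℕ) : ℝ) * (Cc * (C * fnorm τ w * N * E1) * (((m + 1 : ℕ) : ℝ) * K2)) * E2) * K4 *
      Real.exp (-(μ / 2 / 2 * (linfDist x y : ℝ))) = C5 * Real.exp (-(μ / 2 / 2 * (linfDist x y : ℝ))) * fnorm τ w := by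
    rw [hC5]; ring
  calc fnorm τ ((f : Site d → 𝔸) x) + fnorm τ ((v4 : Site d → 𝔸) x)
      ≤ Real.exp (-(μ / 2 / 2 * (linfDist x y : ℝ))) * fnorm τ w + C5 * Real.exp (-(μ / 2 / 2 * (linfDist x y : ℝ))) * fnorm τ w :=
        add_le_add hδ (h5.trans (le_of_eq hfac))
    _ = (1 + C5) * Real.exp (-(μ / 2 / 2 * (linfDist x y : ℝ))) * fnorm τ w := by ring

end Station3

end Literature.MathematicalPhysics.QuantumFieldTheory.Balaban1983to89.B9Eq325RKernelDecayZd

end
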